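import Summits.QuantumFields.YangMills.Theorems.AlphaInputsT3ACv3ProfileRegionR3
import Summits.QuantumFields.YangMills.Theorems.AlphaInputsT3ACv3InnerLiftFine
import HarnessLib

/-!
# `AlphaInputsT3ACv3RecordFL` — STRATEGY B for 2′: THE RECORD-PARAMETRIC DISPLAY OF 2′ WITH THE ONE W-DEPENDENT KINEMATIC ROW REDUCED TO **(FL)** — an exact
# `k`-fold (0.4)-lift of the charged datum on `Ω_k(h)` whose finest plaquettes under `Ω_k(h)` are `B₃·ε_W·L^{−2k}`-small — and the registered 2′ text
# `AlphaInputsT3ACv3Rec L` from it — lane `pub-balaban3d`, seat alpha-2 (g4)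

WHY (HOME memos `D6R-SEAMS-alpha2-g4.md`, `D6X-GLUE-alpha2-g4.md`).  After this generation the displayed kinematic row of 2′ went (D6R-CHARGED) ↦ (D6X-CHARGED) (seam-blind class,
`…v3CoreNonemptyX`) ⇐ (EL) ∧ (OP) (free-seam glue, `…v3ChargedGlueX`) with (OP) ⇐ collar (`…v3ProfileRegionR3`), and (EL) ⇐ (FL) + window∕budget sizes (`…v3InnerLiftFine`).  THIS FILE
discharges the window∕budget sizes of that last step from the RECORD's size rows (`MinimiserPin.small_of_C68` ∕ `anti_of_C68` ∕ `C68_dom_of_le`, the rows `hA3` ∕ `hA2` of the (40)-window)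
and writes the display: §1 ★★ `innerExactLiftT3_of_fineLifts_of_sizes` ((EL) ⇐ (FL) at `B := B₃` under `hA3, hA2, 4B₃L²·avgWindowFactor ≤ C68, hCe, hCa`), ★★
`adaptedClassNonemptyChargedT3X_of_fineLifts_of_sizes` ((D6X-CHARGED) ⇐ (FL) + sizes incl. `7L+3 ≤ M₁`, `1 ≤ 2B₃`); §2 the display **`PinnedPartsT3ACRecFL L`** = `PinnedPartsT3ACRecX L`
with (D6X-CHARGED) replaced by **(FL) `InnerFineLiftsT3 … B₃`**, and ★★★ **`alphaInputsT3ACv3Rec_of_pinnedPartsRecFL : PinnedPartsT3ACRecFL L → AlphaInputsT3ACv3Rec L`** — the registered 2′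
text BY NAME from: (T) `Thm1GlobalMinAt` · the record sizes · (FL) · (O″) the data rows over `𝒞_X`.
WHAT (FL) IS.  For every admissible non-trivial `(k, h)` and every CHARGED `W` (window `ε_W = 2L²·avgWindowFactor·θ(K−k+1)` on `plaqsIn k Ω_k(h)`): a finest-lattice field with EXACT `k`-fold
`blockAvg ℰp`-averages `W` on `bondsIn k Ω_k(h)` and every finest plaquette with four corners in `Ω_k(h)` within `B₃·ε_W·L^{−2k}` of `1` — the non-emptiness of [Balaban1985Variational]'s space (8)
for the ONE region `Ω_k(h)` with FREE boundary (Thm 1 (8) p.279's existence clause is printed for the nested Dirichlet-collared sequences of [B10] §A; the free-boundary region case is a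
LOCATED specialisation — abelian data: explicit; non-abelian: [B11] (11)–(13)'s construction).
HONEST FRAMING.  (T), (FL) and (O″) stay DISPLAYED (hypothesis schemas, never asserted); every other row of the display is a size condition met by `exists_record_sizes_M₁`-type records;
nothing of [B10]∕[7]∕[4]'s estimates asserted beyond the tree's proved [B7] Props. 1–2; count-neutral helper toward R3 2′ (`stub_laneRecordsV3`, items 19935∕19936); registry untouched;
nothing about d = 4, the continuum, or a mass gap.

References: T. Bałaban, CMP 102 (1985) 255–275 [Balaban1985UV3] ((7) p.257, (40)–(42) p.266, (67)–(68) p.273, Thm 2 p.272); CMP 102 (1985) 277–309 [Balaban1985Variational]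
(Thm 1 (6)–(8) pp.278–279); CMP 98 (1985) 17–51 [Balaban1985Averaging] (Props. 1–2 p.26).
-/

set_option autoImplicit false

noncomputable section

namespace Summit.QuantumFields.YangMills.Theorems

open MeasureTheory Set
open scoped Matrix.Norms.L2Operator
open Literature.MathematicalPhysics.QuantumFieldTheory.Balaban1983to89
open Literature.MathematicalPhysics.QuantumFieldTheory.Balaban1983to89.T3ContinuumYM3Torus
open Literature.MathematicalPhysics.QuantumFieldTheory.Balaban1983to89.T3UnitLawDensityEML (ℰp)
open Literature.MathematicalPhysics.QuantumFieldTheory.Balaban1983to89.T3UnitScaleTilt (θBal)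
open Literature.MathematicalPhysics.QuantumFieldTheory.Balaban1983to89.T3PrintedMinimiserExistence (Thm1GlobalMinAt)
open Literature.MathematicalPhysics.QuantumFieldTheory.Balaban1983to89.T3Thresholds (sqrt_le_exp_iff)
open Literature.MathematicalPhysics.QuantumFieldTheory.Balaban1983to89.T3MinimiserStabilityReduction (θBal_pos)
open Literature.MathematicalPhysics.QuantumFieldTheory.Balaban1983to89.ExpMeanLog (deltaSU)
open Literature.MathematicalPhysics.QuantumFieldTheory.Balaban1985CMP102.Setting
open Summit.QuantumFields.Balaban3D.Carriers
open Summit.QuantumFields.Balaban3D.Proofs.Primitives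
open Summit.QuantumFields.Balaban3D.Proofs.Thresholds (Q0 Q0_pos)
open Summit.QuantumFields.YangMills.Theorems.ProfileEnlarged (CollarE)
open B7Prop2Explicit (C0 C0_pos)

/-! ## §1 (EL) and (D6X-CHARGED) from (FL) under the record sizes -/

section Fixed

variable {F : T3Family} {𝔠 : AlphaConsts F.L (suGroupModel 2).N}

/-- **★★ (EL) ⇐ (FL) AT `B := B₃` UNDER THE RECORD SIZES**: the window∕budget provisos of `innerExactLiftT3_of_fineLifts` (`C₀(3)·B₃ε_W ≤ ⅓`, `2B₃ε_W ≤ c′₂`, `(5L)²·2B₃ε_W/4 ≤ δ/2`,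
`2B₃ε_W(k) ≤ C68·θ(K−k)`) follow from `ε_W(k) ≤ a₁` (`MinimiserPin.small_of_C68` ⇐ `hCa`), the (40)-window rows `hA3`, `hA2`, and `4B₃L²·avgWindowFactor ≤ C68` with the antitone
regime `hCe` (`MinimiserPin.C68_dom_of_le` at `i = k`). [cite: Balaban1985Variational, Thm 1 (8) p.279; Balaban1985UV3, (40) p.266 + (68) p.273] -/
theorem AlphaInputsT3AC.innerExactLiftT3_of_fineLifts_of_sizes {a₁ : ℝ} (ha₁ : 0 < a₁)
    (hA3 : (143 * ((((3 + 4 : ℕ) : ℝ)) ^ 2 / 4) ^ 2) * (2 * (𝔠.B₃ * a₁)) ≤ 1 / 3)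
    (hA2 : 2 * (2 * (𝔠.B₃ * a₁)) ≤ 2 * deltaSU (Fin 2) / (((3 + 4) * F.L : ℕ) : ℝ) ^ 2)
    (hC : 4 * 𝔠.B₃ * (F.L : ℝ) ^ 2 * avgWindowFactor F.L ≤ 𝔠.C68)
    (hCe : Real.exp (𝔠.p₀ - 1) ≤ 3 * C0 3 * 𝔠.C68 * (𝔠.b₀ * Q0 𝔠.p₀))
    (hCa : (𝔠.b₀ * Q0 𝔠.p₀) * (2 * (F.L : ℝ) ^ 2 * avgWindowFactor F.L) ^ 2 ≤ 3 * C0 3 * 𝔠.C68 * a₁ ^ 2)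
    {γ : ℝ} (hγ : 0 < γ) (hγ1 : γ ≤ (min 𝔠.gamma0 1) ^ 2) (K : ℕ)
    (hFL : AlphaInputsT3AC.InnerFineLiftsT3 F 𝔠 γ hγ hγ1 K 𝔠.B₃) :
    AlphaInputsT3AC.InnerExactLiftT3 F 𝔠 γ hγ hγ1 K := by
  have hL1 : 1 ≤ F.L := by have := F.hL.2; omega
  have hL0 : (0 : ℝ) < F.L := by exact_mod_cast (zero_lt_one.trans F.hL.2)
  have hγ1' : γ ≤ 1 := hγ1.trans (sq_min_one_le _ 𝔠.gamma0_pos)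
  have hanti := MinimiserPin.anti_of_C68 𝔠 hCe
  have hγe : Real.sqrt γ ≤ Real.exp (1 - 𝔠.p₀) := (sqrt_le_exp_iff hγ.le).mpr (hγ1.trans hanti)
  have hsmall := MinimiserPin.small_of_C68 𝔠 hL1 ha₁ (avgWindowFactor_pos F) hCa γ hγ hγ1 K
  have hB₃ := 𝔠.B₃_pos
  have hAWF := avgWindowFactor_pos F
  have hδ0 : 0 < deltaSU (Fin 2) := ExpMeanLog.deltaSU_pos
  refine AlphaInputsT3AC.innerExactLiftT3_of_fineLifts (hγ := hγ) (hγ1 := hγ1) hB₃ hFL fun k hk => ?_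
  -- the window at `(K, k)`: `ε := 2L²·avgWindowFactor·θ(K−k+1) ≤ a₁`
  set ε : ℝ := 2 * (F.L : ℝ) ^ 2 * avgWindowFactor F.L * θBal F.L γ 𝔠.b₀ 𝔠.p₀ (K - k + 1) with hε
  have hθ : 0 < θBal F.L γ 𝔠.b₀ 𝔠.p₀ (K - k + 1) := θBal_pos hL1 hγ hγ1' 𝔠.b₀_pos 𝔠.p₀ (K - k + 1)
  have hεa : ε ≤ a₁ := hsmall k
  have hε0 : 0 ≤ ε := by rw [hε]; positivity
  have hBε : 𝔠.B₃ * ε ≤ 𝔠.B₃ * a₁ := mul_le_mul_of_nonneg_left hεa hB₃.le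
  have hBa0 : 0 ≤ 𝔠.B₃ * a₁ := by nlinarith
  refine ⟨hθ, ?_, ?_, ?_, ?_⟩
  · -- `C₀·(B₃ε) ≤ C₀·(2B₃a₁) ≤ ⅓`
    have hC₀ : (0 : ℝ) ≤ 143 * ((((3 + 4 : ℕ) : ℝ)) ^ 2 / 4) ^ 2 := by positivity
    calc (143 * ((((3 + 4 : ℕ) : ℝ)) ^ 2 / 4) ^ 2) * (𝔠.B₃ * ε)
        ≤ (143 * ((((3 + 4 : ℕ) : ℝ)) ^ 2 / 4) ^ 2) * (2 * (𝔠.B₃ * a₁)) := mul_le_mul_of_nonneg_left (by linarith) hC₀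
      _ ≤ 1 / 3 := hA3
  · -- `2B₃ε ≤ 4B₃a₁ ≤ c′₂`
    calc 2 * (𝔠.B₃ * ε) ≤ 2 * (2 * (𝔠.B₃ * a₁)) := by linarith
      _ ≤ 2 * deltaSU (Fin 2) / (((3 + 4) * F.L : ℕ) : ℝ) ^ 2 := hA2
  · -- `(5L)²·2B₃ε/4 ≤ (25L²/4)·δ/(49L²) = 25δ/196 ≤ δ/2`
    have h49 : ((((3 + 4) * F.L : ℕ) : ℝ)) ^ 2 = 49 * (F.L : ℝ) ^ 2 := by push_cast; ring
    have h25 : ((((3 + 2) * F.L : ℕ) : ℝ)) ^ 2 = 25 * (F.L : ℝ) ^ 2 := by push_cast; ring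
    have hL2 : (0 : ℝ) < (F.L : ℝ) ^ 2 := by positivity
    have h2B : 2 * (𝔠.B₃ * ε) ≤ deltaSU (Fin 2) / (49 * (F.L : ℝ) ^ 2) := by
      have h := hA2
      rw [h49] at h
      have : 2 * deltaSU (Fin 2) / (49 * (F.L : ℝ) ^ 2) = 2 * (deltaSU (Fin 2) / (49 * (F.L : ℝ) ^ 2)) := by ring
      rw [this] at h
      linarith
    show ((((3 + 2) * F.L : ℕ) : ℝ) ^ 2 / 4) * (2 * (𝔠.B₃ * ε)) ≤ deltaSU (Fin 2) / 2
    rw [h25]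
    calc 25 * (F.L : ℝ) ^ 2 / 4 * (2 * (𝔠.B₃ * ε)) ≤ 25 * (F.L : ℝ) ^ 2 / 4 * (deltaSU (Fin 2) / (49 * (F.L : ℝ) ^ 2)) :=
          mul_le_mul_of_nonneg_left h2B (by positivity)
      _ = 25 / 196 * deltaSU (Fin 2) := by field_simp; ring
      _ ≤ deltaSU (Fin 2) / 2 := by linarith
  · -- budget `2B₃ε ≤ C68·θ(K−k)` (`C68_dom_of_le` at `i = k`)
    have hdom := MinimiserPin.C68_dom_of_le hL1 hγ hγ1' hγe 𝔠.b₀_pos 𝔠.p₀_pos.le hAWF.le hB₃.le hC K k k le_rfl hk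
    simp only [Nat.sub_self, pow_zero, inv_one, one_pow, mul_one] at hdom
    calc 2 * (𝔠.B₃ * ε) = 2 * 𝔠.B₃ * (2 * (F.L : ℝ) ^ 2 * avgWindowFactor F.L * θBal F.L γ 𝔠.b₀ 𝔠.p₀ (K - k + 1)) := by rw [hε]; ring
      _ ≤ 𝔠.C68 * θBal F.L γ 𝔠.b₀ 𝔠.p₀ (K - k) := hdom

/-- **★★ (D6X-CHARGED) ⇐ (FL) UNDER THE RECORD SIZES** (incl. `7L + 3 ≤ M₁`, `1 ≤ 2B₃`): §1 + the collar form of the free-seam glue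
(`adaptedClassNonemptyChargedT3X_of_innerLift_of_collar`: (OP) from the profile under (N2′) ⇐ `7L+3 ≤ M₁` and `4π ≤ C68` ⇐ `1 ≤ 2B₃ ∧ 4B₃L²·avgWindowFactor ≤ C68`).
[cite: Balaban1985UV3, (7) p.257, (40)–(42) p.266 + (67)–(68) p.273; Balaban1985Variational, Thm 1 (8) p.279] -/
theorem AlphaInputsT3AC.adaptedClassNonemptyChargedT3X_of_fineLifts_of_sizes {a₁ : ℝ} (ha₁ : 0 < a₁)
    (hA3 : (143 * ((((3 + 4 : ℕ) : ℝ)) ^ 2 / 4) ^ 2) * (2 * (𝔠.B₃ * a₁)) ≤ 1 / 3)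
    (hA2 : 2 * (2 * (𝔠.B₃ * a₁)) ≤ 2 * deltaSU (Fin 2) / (((3 + 4) * F.L : ℕ) : ℝ) ^ 2)
    (hB₃ : 1 ≤ 2 * 𝔠.B₃) (hC : 4 * 𝔠.B₃ * (F.L : ℝ) ^ 2 * avgWindowFactor F.L ≤ 𝔠.C68)
    (hCe : Real.exp (𝔠.p₀ - 1) ≤ 3 * C0 3 * 𝔠.C68 * (𝔠.b₀ * Q0 𝔠.p₀))
    (hCa : (𝔠.b₀ * Q0 𝔠.p₀) * (2 * (F.L : ℝ) ^ 2 * avgWindowFactor F.L) ^ 2 ≤ 3 * C0 3 * 𝔠.C68 * a₁ ^ 2)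
    (hM₁ : 7 * F.L + 3 ≤ 𝔠.M₁)
    {γ : ℝ} (hγ : 0 < γ) (hγ1 : γ ≤ (min 𝔠.gamma0 1) ^ 2) (K : ℕ)
    (hFL : AlphaInputsT3AC.InnerFineLiftsT3 F 𝔠 γ hγ hγ1 K 𝔠.B₃) :
    AlphaInputsT3AC.AdaptedClassNonemptyChargedT3X F 𝔠 γ hγ hγ1 K :=
  AlphaInputsT3AC.adaptedClassNonemptyChargedT3X_of_innerLift_of_collar (hγ1 := hγ1)
    (AlphaInputsT3AC.collarE_T3_of_M₁_ge (hγ := hγ) (hγ1 := hγ1) (K := K) hM₁)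
    (AlphaInputsT3AC.four_pi_le_C68_of_sizes (𝔠 := 𝔠) hB₃ hC)
    (AlphaInputsT3AC.innerExactLiftT3_of_fineLifts_of_sizes ha₁ hA3 hA2 hC hCe hCa hγ hγ1 K hFL)

end Fixed

/-! ## §2 The record-parametric display of 2′ with (FL), and the registered text from it -/

section Record

/-- **2′ DISPLAYED WITH (FL)** — `PinnedPartsT3ACRecX` with the kinematic row (D6X-CHARGED) replaced by **(FL) `InnerFineLiftsT3 … B₃`** (exact `k`-fold lifts of the charged data on
`Ω_k(h)` with `B₃·ε_W·L^{−2k}`-regular finest plaquettes UNDER `Ω_k(h)`; print's `B₃` of Thm 1 (8)). [cite: Balaban1985UV3, (7) p.257, (40)–(42) p.266, (68) p.273 and Thm 2 p.272;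
Balaban1985Variational, Thm 1 (6)–(8) pp.278–279; Balaban1985Averaging, Props. 1–2 p.26] -/
def AlphaInputsT3AC.PinnedPartsT3ACRecFL (L : ℕ) : Prop :=
  ∃ (b₁ p₁ : ℝ), ∀ (b₀ p₀ : ℝ), b₁ ≤ b₀ → p₁ ≤ p₀ →
    ∃ (𝔠 : AlphaConsts L (suGroupModel 2).N) (a₀ a₁ : ℝ), 𝔠.b₀ = b₀ ∧ 𝔠.p₀ = p₀ ∧ 0 < a₀ ∧ 0 < a₁ ∧ 𝔠.B₃ * a₁ ≤ a₀ ∧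
      (143 * ((((3 + 4 : ℕ) : ℝ)) ^ 2 / 4) ^ 2) * (2 * (𝔠.B₃ * a₁)) ≤ 1 / 3 ∧
      2 * (2 * (𝔠.B₃ * a₁)) ≤ 2 * deltaSU (Fin 2) / (((3 + 4) * L : ℕ) : ℝ) ^ 2 ∧
      1 ≤ 2 * 𝔠.B₃ ∧ 4 * 𝔠.B₃ * (L : ℝ) ^ 2 * avgWindowFactor L ≤ 𝔠.C68 ∧
      Real.exp (𝔠.p₀ - 1) ≤ 3 * C0 3 * 𝔠.C68 * (𝔠.b₀ * Q0 𝔠.p₀) ∧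
      (𝔠.b₀ * Q0 𝔠.p₀) * (2 * (L : ℝ) ^ 2 * avgWindowFactor L) ^ 2 ≤ 3 * C0 3 * 𝔠.C68 * a₁ ^ 2 ∧
      7 * L + 3 ≤ 𝔠.M₁ ∧
      Thm1GlobalMinAt L a₀ a₁ 𝔠.B₃ ∧
      ∀ (F : T3Family) (hF : F.L = L),
        (∀ (γ : ℝ) (hγ : 0 < γ) (hγ1 : γ ≤ (min (hF ▸ 𝔠).gamma0 1) ^ 2) (K : ℕ),
          AlphaInputsT3AC.InnerFineLiftsT3 F (hF ▸ 𝔠) γ hγ hγ1 K (hF ▸ 𝔠).B₃) ∧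
        (∀ (γ : ℝ) (hγ : 0 < γ) (hγ1 : γ ≤ (min (hF ▸ 𝔠).gamma0 1) ^ 2) (K : ℕ),
          (∃ Ut : (k : ℕ) → GaugeField (F.P K) k (Matrix.specialUnitaryGroup (Fin 2) ℂ) → GaugeField (F.P K) 0 (Matrix.specialUnitaryGroup (Fin 2) ℂ),
            AlphaInputsT3AC.TrivMinimiserRowsT3 F (hF ▸ 𝔠) γ hγ hγ1 a₀ a₁ K Ut) →
          ∃ Ut : (k : ℕ) → GaugeField (F.P K) k (Matrix.specialUnitaryGroup (Fin 2) ℂ) → GaugeField (F.P K) 0 (Matrix.specialUnitaryGroup (Fin 2) ℂ),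
            AlphaInputsT3AC.TrivMinimiserRowsT3 F (hF ▸ 𝔠) γ hγ hγ1 a₀ a₁ K Ut ∧ AlphaInputsT3AC.DataRowsT3X F (hF ▸ 𝔠) γ hγ hγ1 K Ut)

/-- Transport along `hF : F.L = L`: at a family of block size `L` the (FL) clause of the display gives the (D6X-CHARGED) clause of `PinnedPartsT3ACRecX` (§1 after `subst`).
[cite: Balaban1985Variational, Thm 1 (8) p.279; Balaban1985UV3, (40)–(42) p.266 + (68) p.273] -/
theorem AlphaInputsT3AC.chargedX_of_fineLifts_cast {L : ℕ} {𝔠 : AlphaConsts L (suGroupModel 2).N} {a₁ : ℝ} (ha₁ : 0 < a₁)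
    (hA3 : (143 * ((((3 + 4 : ℕ) : ℝ)) ^ 2 / 4) ^ 2) * (2 * (𝔠.B₃ * a₁)) ≤ 1 / 3)
    (hA2 : 2 * (2 * (𝔠.B₃ * a₁)) ≤ 2 * deltaSU (Fin 2) / (((3 + 4) * L : ℕ) : ℝ) ^ 2)
    (hB₃ : 1 ≤ 2 * 𝔠.B₃) (hC : 4 * 𝔠.B₃ * (L : ℝ) ^ 2 * avgWindowFactor L ≤ 𝔠.C68)
    (hCe : Real.exp (𝔠.p₀ - 1) ≤ 3 * C0 3 * 𝔠.C68 * (𝔠.b₀ * Q0 𝔠.p₀))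
    (hCa : (𝔠.b₀ * Q0 𝔠.p₀) * (2 * (L : ℝ) ^ 2 * avgWindowFactor L) ^ 2 ≤ 3 * C0 3 * 𝔠.C68 * a₁ ^ 2)
    (hM₁ : 7 * L + 3 ≤ 𝔠.M₁) (F : T3Family) (hF : F.L = L)
    (hFL : ∀ (γ : ℝ) (hγ : 0 < γ) (hγ1 : γ ≤ (min (hF ▸ 𝔠).gamma0 1) ^ 2) (K : ℕ),
      AlphaInputsT3AC.InnerFineLiftsT3 F (hF ▸ 𝔠) γ hγ hγ1 K (hF ▸ 𝔠).B₃) :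
    ∀ (γ : ℝ) (hγ : 0 < γ) (hγ1 : γ ≤ (min (hF ▸ 𝔠).gamma0 1) ^ 2) (K : ℕ),
      AlphaInputsT3AC.AdaptedClassNonemptyChargedT3X F (hF ▸ 𝔠) γ hγ hγ1 K := by
  subst hF
  exact fun γ hγ hγ1 K =>
    AlphaInputsT3AC.adaptedClassNonemptyChargedT3X_of_fineLifts_of_sizes ha₁ hA3 hA2 hB₃ hC hCe hCa hM₁ hγ hγ1 K (hFL γ hγ hγ1 K)

/-- **THE (FL)-DISPLAY IMPLIES THE (D6X-CHARGED)-DISPLAY** `PinnedPartsT3ACRecX` (same record, §1 row by row). [cite: Balaban1985UV3, Thm 2 p.272; Balaban1985Variational, Thm 1 (8) p.279] -/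
theorem AlphaInputsT3AC.pinnedPartsT3ACRecX_of_recFL {L : ℕ} (h : AlphaInputsT3AC.PinnedPartsT3ACRecFL L) : AlphaInputsT3AC.PinnedPartsT3ACRecX L := by
  obtain ⟨b₁, p₁, h⟩ := h
  refine ⟨b₁, p₁, fun b₀ p₀ hb hp => ?_⟩
  obtain ⟨𝔠, a₀, a₁, h1, h2, h3, h4, h5, hA3, hA2, hB₃, hC, hCe, hCa, hM₁, hT, hD⟩ := h b₀ p₀ hb hp
  exact ⟨𝔠, a₀, a₁, h1, h2, h3, h4, h5, hA3, hA2, hB₃, hC, hCe, hCa, hM₁, hT, fun F hF =>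
    ⟨AlphaInputsT3AC.chargedX_of_fineLifts_cast h4 hA3 hA2 hB₃ hC hCe hCa hM₁ F hF (hD F hF).1, (hD F hF).2⟩⟩

/-- ★★★ **THE REGISTERED 2′ TEXT FROM ITS (FL)-DISPLAY**: `PinnedPartsT3ACRecFL L → AlphaInputsT3ACv3Rec L` — 2′ `stub_laneRecordsV3` re-cut to «(T) [7] Thm 1 + the record sizes + **(FL)**
(exact `k`-fold (0.4)-lifts of the charged data with regular finest plaquettes under `Ω_k(h)`) + (O″) the data rows over the seam-blind class `𝒞_X`».
[cite: Balaban1985UV3, Thm 2 p.272; Balaban1985Variational, Thm 1 (8) p.279] -/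
theorem alphaInputsT3ACv3Rec_of_pinnedPartsRecFL {L : ℕ} (h : AlphaInputsT3AC.PinnedPartsT3ACRecFL L) : AlphaInputsT3ACv3Rec L :=
  alphaInputsT3ACv3Rec_of_pinnedPartsRecX (AlphaInputsT3AC.pinnedPartsT3ACRecX_of_recFL h)

end Record

end Summit.QuantumFields.YangMills.Theorems

end
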